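import Summits.CriticalPhenomena.SAWScalingLimit.Theorems.SAWTensorRGRestrictionOfLimitRadoChart
import Summits.CriticalPhenomena.SAWScalingLimit.Theorems.SAWTensorRGRestrictionOfLimitRadoTwoSided
import HarnessLib

/-!
# Radó squeezes, part 8: defect data of a free arc (sides, normalised parameters, chart)

Support file (`--supports stmt-CriticalPhenomena-0773`, towards the registered stub `stub_radoSqueezeFamily`,
geometry F′ of the line `birth` for the crux `RestrictionOfLimit`). Pure plane topology.

We bundle, for a free parameter `x` of the window of a Jordan sub-domain `D' ⊆ D` (parts 2–6), its DEFECT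
DATA (`DefectData`): the two sides `U`, `U'` of the closed free arc `ᾱ` (Newman, part 3) with `D' ⊆ U'`, the
parameters `s < t < s + 1` of the arc `β = D.boundary '' [s, t]` of `∂D` bounding `U`, NORMALISED into the
window `[D.mark 0, D.mark 0 + 1]` of `∂D` (possible because the open arc `β ∖ {P, Q}` misses the marked point
`a ∈ closure D'`), and a Schoenflies chart `G` of `U` from the model half-disc (part 6). Existence
(`nonempty_defectData`) and the basic consequences used by the squeeze are recorded, in particular: the open
arc `D.boundary '' (s, t)` misses `closure D'` and `{P, Q}`, near its points `D` coincides with `U`, and the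
closures of the defect sides of two free parameters with different components meet at most in `{P, Q}`.

References: M. H. A. Newman (1939), Ch. V §11; Ch. Pommerenke (1992), §2.3. Axioms `propext`,
`Classical.choice`, `Quot.sound`.
-/

noncomputable section

open Set Filter Topology Metric Complex
open Literature.Topology.PlaneTopology Literature.Probability.RandomPlanarGeometry

namespace Summit.CriticalPhenomena.SAWScalingLimit.Theorems.RestrictionOfLimit.Birth

/-- **Defect data of a free parameter** `x`: sides `U ⊔ U' = D ∖ ᾱ` of its closed free arc with `D' ⊆ U'`,
normalised parameters `s < t` of the arc `β = D.boundary '' [s, t]` with `frontier U = ᾱ ∪ β`, and a Schoenflies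
chart `G` of `U` from the model half-disc sending the base diameter onto `ᾱ` linearly in the parameter and the
open semicircle into `β ∖ {P, Q}`. [folklore] -/
structure DefectData (D D' : DobrushinDomain) (F : Set ℝ) (x : ℝ) where
  /-- The defect side. -/
  U : Set ℂ
  /-- The side containing `D'`. -/
  U' : Set ℂ
  /-- First parameter of the arc `β` of `∂D`. -/
  s : ℝ
  /-- Second parameter of the arc `β` of `∂D`. -/
  t : ℝ
  /-- The chart of the defect side. -/
  G : ℂ ≃ₜ ℂ
  hst : s < t
  hts : t < s + 1
  hμs : D.mark 0 ≤ s
  htμ : t ≤ D.mark 0 + 1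
  hUo : IsOpen U
  hU'o : IsOpen U'
  hUc : IsConnected U
  hU'c : IsConnected U'
  hdisj : Disjoint U U'
  hunion : U ∪ U' = D.carrier \
    (D'.boundary '' Icc (sInf (connectedComponentIn F x)) (sSup (connectedComponentIn F x)))
  hfrU : frontier U = (D'.boundary '' Icc (sInf (connectedComponentIn F x)) (sSup (connectedComponentIn F x))) ∪
    D.boundary '' Icc s t
  hfrU' : frontier U' = (D'.boundary '' Icc (sInf (connectedComponentIn F x)) (sSup (connectedComponentIn F x))) ∪
    D.boundary '' Icc t (s + 1)
  hD'U : D'.carrier ⊆ U'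
  hends : (D.boundary s = D'.boundary (sInf (connectedComponentIn F x)) ∧
      D.boundary t = D'.boundary (sSup (connectedComponentIn F x))) ∨
    (D.boundary s = D'.boundary (sSup (connectedComponentIn F x)) ∧
      D.boundary t = D'.boundary (sInf (connectedComponentIn F x)))
  hG1 : ∀ u ∈ Icc (0 : ℝ) 1, G (bPar u) = D'.boundary (sInf (connectedComponentIn F x) +
    (sSup (connectedComponentIn F x) - sInf (connectedComponentIn F x)) * u)
  hG2 : ∀ z : ℂ, ‖z‖ = 1 → 0 < z.im → G z ∈ D.boundary '' Icc s t ∧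
    G z ≠ D'.boundary (sInf (connectedComponentIn F x)) ∧ G z ≠ D'.boundary (sSup (connectedComponentIn F x))
  hG3 : G '' {z : ℂ | ‖z‖ < 1 ∧ 0 < z.im} = U
  hG4 : G '' {z : ℂ | ‖z‖ ≤ 1 ∧ 0 ≤ z.im} = closure U

/-- Arcs of a boundary loop shifted by an integer number of periods. [folklore] -/
theorem image_boundary_Icc_add_int (E : JordanDomain) (u v : ℝ) (k : ℤ) :
    E.boundary '' Icc (u + k) (v + k) = E.boundary '' Icc u v := by
  rw [← image_add_const_Icc, image_image]
  refine image_congr fun y _ ↦ ?_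
  rw [show y + (k : ℝ) = y + k * 1 by ring]
  exact E.periodic_boundary.int_mul k y

section Basic

variable {D D' : DobrushinDomain} {F : Set ℝ} (hF : F = {θ : ℝ | D'.boundary θ ∈ D.carrier})
  (hsub : D'.carrier ⊆ D.carrier) (h0 : D'.pt 0 = D.pt 0) (h1 : D'.pt 1 = D.pt 1) {x : ℝ} (hx : x ∈ F)
  (hxw : x ∈ Ioo (D'.mark 0) (D'.mark 0 + 1))

/-- **Points of the open arc `β ∖ {P, Q}` are off `closure D'` and off `{P, Q}`** (for sides presented with
arbitrary, not necessarily normalised, parameters). [folklore] -/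
theorem boundary_Ioo_facts (hF : F = {θ : ℝ | D'.boundary θ ∈ D.carrier}) (hsub : D'.carrier ⊆ D.carrier)
    (h0 : D'.pt 0 = D.pt 0) (h1 : D'.pt 1 = D.pt 1) (hx : x ∈ F) (hxw : x ∈ Ioo (D'.mark 0) (D'.mark 0 + 1))
    {U U' : Set ℂ} {s t : ℝ} (hst : s < t) (hts : t < s + 1)
    (hunion : U ∪ U' = D.carrier \
      (D'.boundary '' Icc (sInf (connectedComponentIn F x)) (sSup (connectedComponentIn F x))))
    (hfrU' : frontier U' = (D'.boundary '' Icc (sInf (connectedComponentIn F x)) (sSup (connectedComponentIn F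
        x))) ∪
      D.boundary '' Icc t (s + 1))
    (hD'U : D'.carrier ⊆ U')
    (hends : (D.boundary s = D'.boundary (sInf (connectedComponentIn F x)) ∧
        D.boundary t = D'.boundary (sSup (connectedComponentIn F x))) ∨
      (D.boundary s = D'.boundary (sSup (connectedComponentIn F x)) ∧
        D.boundary t = D'.boundary (sInf (connectedComponentIn F x))))
    {v : ℝ} (hv : v ∈ Ioo s t) :
    D.boundary v ≠ D'.boundary (sInf (connectedComponentIn F x)) ∧
      D.boundary v ≠ D'.boundary (sSup (connectedComponentIn F x)) ∧ D.boundary v ∉ closure D'.carrier := by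
  have hvs : D.boundary v ≠ D.boundary s := fun h ↦ by
    have := D.injOn_boundary_Ico s ⟨hv.1.le, by linarith [hv.2]⟩ ⟨le_rfl, by linarith⟩ h
    linarith [hv.1]
  have hvt : D.boundary v ≠ D.boundary t := fun h ↦ by
    have := D.injOn_boundary_Ico s ⟨hv.1.le, by linarith [hv.2]⟩ ⟨hst.le, hts⟩ h
    linarith [hv.2]
  have hP : D.boundary v ≠ D'.boundary (sInf (connectedComponentIn F x)) := fun h ↦ by
    rcases hends with ⟨hs, -⟩ | ⟨-, ht⟩
    · exact hvs (h.trans hs.symm)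
    · exact hvt (h.trans ht.symm)
  have hQ : D.boundary v ≠ D'.boundary (sSup (connectedComponentIn F x)) := fun h ↦ by
    rcases hends with ⟨-, ht⟩ | ⟨hs, -⟩
    · exact hvt (h.trans ht.symm)
    · exact hvs (h.trans hs.symm)
  refine ⟨hP, hQ, fun hcl ↦ ?_⟩
  have hmem := beta_inter_closure hF hsub h0 h1 hx hxw hst hts hunion hfrU' hD'U hends
    ⟨⟨v, ⟨hv.1.le, hv.2.le⟩, rfl⟩, hcl⟩
  rcases hmem with h | h
  · exact hP h
  · exact hQ h

/-- **Defect data exist** for every free parameter of the window. [folklore] -/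
theorem nonempty_defectData (hF : F = {θ : ℝ | D'.boundary θ ∈ D.carrier}) (hsub : D'.carrier ⊆ D.carrier)
    (h0 : D'.pt 0 = D.pt 0) (h1 : D'.pt 1 = D.pt 1) (hx : x ∈ F) (hxw : x ∈ Ioo (D'.mark 0) (D'.mark 0 + 1)) :
    Nonempty (DefectData D D' F x) := by
  obtain ⟨U, U', s₀, t₀, hst₀, hts₀, hUo, hU'o, hUc, hU'c, hdisj, hunion, hfrU, hfrU', hD'U, hends₀⟩ :=
    exists_sides hF hsub h0 h1 hx hxw
  -- normalise the parameters into the window of `∂D`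
  set μ : ℝ := D.mark 0 with hμ
  set k : ℤ := ⌊s₀ - μ⌋ with hk
  set s : ℝ := s₀ - k with hs
  set t : ℝ := t₀ - k with ht
  have hst : s < t := by rw [hs, ht]; linarith
  have hts : t < s + 1 := by rw [hs, ht]; linarith
  have hμs : μ ≤ s := by
    have := Int.floor_le (s₀ - μ); rw [hs, hk]; linarith
  have hs1 : s < μ + 1 := by
    have := Int.lt_floor_add_one (s₀ - μ); rw [hs, hk]; linarith
  have hbs : D.boundary s = D.boundary s₀ := by
    rw [hs, show s₀ - (k : ℝ) = s₀ - k * 1 by ring]; exact D.periodic_boundary.sub_int_mul_eq k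
  have hbt : D.boundary t = D.boundary t₀ := by
    rw [ht, show t₀ - (k : ℝ) = t₀ - k * 1 by ring]; exact D.periodic_boundary.sub_int_mul_eq k
  have hIcc : D.boundary '' Icc s t = D.boundary '' Icc s₀ t₀ := by
    have := image_boundary_Icc_add_int D.toJordanDomain s t k
    rw [hs, ht, sub_add_cancel, sub_add_cancel] at this
    exact this.symm
  have hIcc' : D.boundary '' Icc t (s + 1) = D.boundary '' Icc t₀ (s₀ + 1) := by
    have := image_boundary_Icc_add_int D.toJordanDomain t (s + 1) k
    rw [hs, ht, sub_add_cancel, show s₀ - (k : ℝ) + 1 + k = s₀ + 1 by ring] at this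
    exact this.symm
  have hfrU₁ : frontier U = (D'.boundary '' Icc (sInf (connectedComponentIn F x)) (sSup (connectedComponentIn F
      x))) ∪
      D.boundary '' Icc s t := by rw [hIcc]; exact hfrU
  have hfrU'₁ : frontier U' = (D'.boundary '' Icc (sInf (connectedComponentIn F x)) (sSup (connectedComponentIn F
      x))) ∪
      D.boundary '' Icc t (s + 1) := by rw [hIcc']; exact hfrU'
  have hends : (D.boundary s = D'.boundary (sInf (connectedComponentIn F x)) ∧
      D.boundary t = D'.boundary (sSup (connectedComponentIn F x))) ∨
      (D.boundary s = D'.boundary (sSup (connectedComponentIn F x)) ∧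
        D.boundary t = D'.boundary (sInf (connectedComponentIn F x))) := by
    rw [hbs, hbt]; exact hends₀
  -- the open arc misses `a`, so `t ≤ μ + 1`
  have htμ : t ≤ μ + 1 := by
    by_contra hlt
    rw [not_le] at hlt
    have hv : μ + 1 ∈ Ioo s t := ⟨hs1, hlt⟩
    obtain ⟨-, -, hcl⟩ := boundary_Ioo_facts hF hsub h0 h1 hx hxw hst hts hunion hfrU'₁ hD'U hends hv
    apply hcl
    rw [D.periodic_boundary, hμ, show D.boundary (D.mark 0) = D.pt 0 from rfl, ← h0]
    exact frontier_subset_closure (D'.pt_mem_frontier 0)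
  obtain ⟨G, hG1, hG2, hG3, hG4⟩ := exists_chart hF hsub h0 h1 hx hxw hst hts hUo hUc hunion hfrU₁ hends
  exact ⟨⟨U, U', s, t, G, hst, hts, hμs, htμ, hUo, hU'o, hUc, hU'c, hdisj, hunion, hfrU₁, hfrU'₁, hD'U, hends,
    hG1, hG2, hG3, hG4⟩⟩

end Basic

namespace DefectData

variable {D D' : DobrushinDomain} {F : Set ℝ} {x : ℝ} (d : DefectData D D' F x)

/-- The defect side lies in `D`. [folklore] -/
theorem U_subset : d.U ⊆ D.carrier := side_subset d.hunion

/-- The defect side misses `closure D'`. [folklore] -/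
theorem U_inter_closure : d.U ∩ closure D'.carrier = ∅ := side_inter_closure d.hUo d.hdisj d.hD'U

/-- The defect side is bounded. [folklore] -/
theorem isBounded_U : Bornology.IsBounded d.U := D.isBounded.subset d.U_subset

/-- The chart maps the open half-disc into the defect side. [folklore] -/
theorem G_mem_U {z : ℂ} (hz : ‖z‖ < 1) (hz0 : 0 < z.im) : d.G z ∈ d.U :=
  d.hG3 ▸ mem_image_of_mem _ ⟨hz, hz0⟩

/-- The chart maps the closed half-disc into the closure of the defect side. [folklore] -/
theorem G_mem_closure {z : ℂ} (hz : ‖z‖ ≤ 1) (hz0 : 0 ≤ z.im) : d.G z ∈ closure d.U :=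
  d.hG4 ▸ mem_image_of_mem _ ⟨hz, hz0⟩

/-- The closed free arc lies in the frontier, hence in the closure, of the defect side. [folklore] -/
theorem boundary_mem_closure {θ : ℝ} (hθ : θ ∈ Icc (sInf (connectedComponentIn F x)) (sSup (connectedComponentIn
    F x))) :
    D'.boundary θ ∈ frontier d.U ∧ D'.boundary θ ∈ closure d.U := by
  have h : D'.boundary θ ∈ frontier d.U := by rw [d.hfrU]; exact Or.inl ⟨θ, hθ, rfl⟩
  exact ⟨h, frontier_subset_closure h⟩

/-- **Chart points of the open semicircle** lie on the open arc `β ∖ {P, Q}`. [folklore] -/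
theorem G_semicircle {z : ℂ} (hz : ‖z‖ = 1) (hz0 : 0 < z.im) :
    ∃ v ∈ Ioo d.s d.t, d.G z = D.boundary v := by
  obtain ⟨⟨v, hv, hvz⟩, hP, hQ⟩ := d.hG2 z hz hz0
  refine ⟨v, ⟨lt_of_le_of_ne hv.1 fun h ↦ ?_, lt_of_le_of_ne hv.2 fun h ↦ ?_⟩, hvz.symm⟩
  · rcases d.hends with ⟨hs, -⟩ | ⟨hs, -⟩
    · exact hP (by rw [← hvz, ← h, hs])
    · exact hQ (by rw [← hvz, ← h, hs])
  · rcases d.hends with ⟨-, ht⟩ | ⟨-, ht⟩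
    · exact hQ (by rw [← hvz, h, ht])
    · exact hP (by rw [← hvz, h, ht])

variable (hF : F = {θ : ℝ | D'.boundary θ ∈ D.carrier}) (hsub : D'.carrier ⊆ D.carrier)
  (h0 : D'.pt 0 = D.pt 0) (h1 : D'.pt 1 = D.pt 1) (hx : x ∈ F) (hxw : x ∈ Ioo (D'.mark 0) (D'.mark 0 + 1))

include hF hsub h0 h1 hx hxw

/-- **Points of the open arc `β ∖ {P, Q}`** are off `{P, Q}`, off `closure D'`, off `D`, and `D` coincides
with the defect side near them. [folklore] -/
theorem beta_open_facts {v : ℝ} (hv : v ∈ Ioo d.s d.t) :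
    D.boundary v ≠ D'.boundary (sInf (connectedComponentIn F x)) ∧
      D.boundary v ≠ D'.boundary (sSup (connectedComponentIn F x)) ∧ D.boundary v ∉ closure D'.carrier ∧
      D.boundary v ∉ D.carrier ∧ ∃ O ∈ 𝓝 (D.boundary v), O ∩ D.carrier ⊆ d.U := by
  obtain ⟨hP, hQ, hcl⟩ :=
    boundary_Ioo_facts hF hsub h0 h1 hx hxw d.hst d.hts d.hunion d.hfrU' d.hD'U d.hends hv
  exact ⟨hP, hQ, hcl, D.toJordanDomain.boundary_notMem_carrier v,
    side_nhds hF hsub h0 h1 hx hxw d.hts d.hunion d.hfrU' d.hends ⟨v, ⟨hv.1.le, hv.2.le⟩, rfl⟩ hP hQ⟩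

omit hx hxw in
/-- **Closures of defect sides of free parameters with different components meet at most in `{P, Q}`.**
[folklore] -/
theorem closure_inter {y : ℝ} (hx : x ∈ F) (hxw : x ∈ Ioo (D'.mark 0) (D'.mark 0 + 1)) (hy : y ∈ F)
    (hyw : y ∈ Ioo (D'.mark 0) (D'.mark 0 + 1)) (hne : connectedComponentIn F x ≠ connectedComponentIn F y)
    (e : DefectData D D' F y) :
    closure d.U ∩ closure e.U ⊆
      {D'.boundary (sInf (connectedComponentIn F x)), D'.boundary (sSup (connectedComponentIn F x))} :=
  closure_sides_inter hF hsub h0 h1 hx hxw d.hst d.hts d.hUo d.hU'o d.hdisj d.hunion d.hfrU d.hfrU' d.hD'U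
    d.hends d.hUc hy hyw hne e.hts e.hUo e.hU'o e.hUc e.hdisj e.hunion e.hfrU e.hfrU' e.hD'U e.hends

end DefectData

/-- **Registered helper stub `stub_radoData`** (towards `stub_radoSqueezeFamily`, line `birth`): defect data exist
for every free parameter of the window, in closed form. [folklore] -/
theorem stub_radoData :
    ∀ (D D' : DobrushinDomain) (F : Set ℝ), F = {θ : ℝ | D'.boundary θ ∈ D.carrier} →
      D'.carrier ⊆ D.carrier → D'.pt 0 = D.pt 0 → D'.pt 1 = D.pt 1 → ∀ x : ℝ, x ∈ F →
      x ∈ Set.Ioo (D'.mark 0) (D'.mark 0 + 1) →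
      Nonempty (Summit.CriticalPhenomena.SAWScalingLimit.Theorems.RestrictionOfLimit.Birth.DefectData D D' F x) :=
  fun _ _ _ hF hsub h0 h1 _ hx hxw ↦ nonempty_defectData hF hsub h0 h1 hx hxw

end Summit.CriticalPhenomena.SAWScalingLimit.Theorems.RestrictionOfLimit.Birth

end
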